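import Summits.Ventures.HodgeRepro2.T5SU11GaussLegendre
import Mathlib.Topology.ContinuousMap.Weierstrass

/-!
# Gauss–Legendre quadrature converges for every continuous function (Stieltjes' theorem)

With the canonical node set `nodes n := (legPoly n).roots.toFinset` — the `n` zeros of `P_n` (row 400) — and the
weights of row 408, the `n`-point Gauss–Legendre rule is `gaussRule n f = Σ_{i ∈ nodes n} w_i f(x_i)`. For every
`f` continuous on `[−1, 1]`:

  **`gaussRule n f → ∫_{−1}^{1} f` as `n → ∞`**   (`tendsto_gaussRule`),

by Weierstrass' approximation theorem (Mathlib's `exists_polynomial_near_of_continuousOn`): pick a polynomial `p` with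
`|p − f| < ε/5` on `[−1, 1]`; for `2n − 1 ≥ deg p` the rule is exact on `p`, `|∫ (f − p)| ≤ 2 · ε/5`, and
`|gaussRule n (f − p)| ≤ Σ w_i · ε/5 = 2 · ε/5` because the weights are positive and sum to `2` (`abs_gaussRule_le`,
`gaussRule_sub`). The same positivity gives the STABILITY `|gaussRule n f| ≤ 2 · sup_{[−1,1]} |f|`. Nothing is
claimed about (N).

Blind lane: Mathlib + the HodgeRepro2 prefix only; no sorry; axioms ⊆ {propext, Classical.choice,
Quot.sound}.
-/

namespace Summit.Ventures.HodgeRepro2.T5SU11GaussLegendreConvergence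

open Polynomial intervalIntegral Finset Set Filter Topology
open T5SU11SphericalLegendreAll T5SU11JacobiPhaseLawEven T5SU11JacobiLegendreLeading T5SU11LegendreZeros
  T5SU11GaussLegendre

/-! ### The canonical nodes -/

/-- **The Gauss–Legendre nodes**: the zero set of `P_n`, as a `Finset`. -/
noncomputable def nodes (n : ℕ) : Finset ℝ := (legPoly n).roots.toFinset

/-- `#(nodes n) = n`. -/
theorem card_nodes (n : ℕ) : (nodes n).card = n := by
  rw [nodes, Multiset.toFinset_card_of_nodup (card_roots_legPoly n).2, (card_roots_legPoly n).1]

/-- `x ∈ nodes n ↔ P_n(x) = 0`. -/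
theorem mem_nodes {n : ℕ} {x : ℝ} : x ∈ nodes n ↔ legP n x = 0 := by
  rw [nodes, Multiset.mem_toFinset, mem_roots (legPoly_ne_zero n), IsRoot, legP_eq_eval]

/-- Every node is a zero of `P_n`. -/
theorem legP_eq_zero_of_mem_nodes {n : ℕ} {x : ℝ} (hx : x ∈ nodes n) : legP n x = 0 := mem_nodes.mp hx

/-- The nodes lie in `(−1, 1)`. -/
theorem nodes_subset_Ioo (n : ℕ) {x : ℝ} (hx : x ∈ nodes n) : x ∈ Ioo (-1 : ℝ) 1 := by
  obtain ⟨s, hcard, hs, hiff, -⟩ := legendre_zeros n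
  exact hs x ((hiff x).mp (mem_nodes.mp hx))

/-! ### The rule -/

/-- **The `n`-point Gauss–Legendre rule** `gaussRule n f = Σ_{i ∈ nodes n} w_i f(x_i)`. -/
noncomputable def gaussRule (n : ℕ) (f : ℝ → ℝ) : ℝ := ∑ i ∈ nodes n, weight (nodes n) i * f i

/-- The rule is exact on polynomials of degree `≤ 2n − 1` (`n ≥ 1`). -/
theorem gaussRule_eq_integral {n : ℕ} (hn : 1 ≤ n) {p : ℝ[X]} (hp : p.natDegree ≤ 2 * n - 1) :
    gaussRule n (fun x => p.eval x) = ∫ x in (-1 : ℝ)..1, p.eval x :=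
  (gauss_legendre hn (card_nodes n) (fun _ hr => legP_eq_zero_of_mem_nodes hr) hp).symm

/-- The rule is linear: `gaussRule n (f − g) = gaussRule n f − gaussRule n g`. -/
theorem gaussRule_sub (n : ℕ) (f g : ℝ → ℝ) :
    gaussRule n (fun x => f x - g x) = gaussRule n f - gaussRule n g := by
  simp only [gaussRule, mul_sub, Finset.sum_sub_distrib]

/-- **Stability**: `|gaussRule n f| ≤ 2 C` whenever `|f| ≤ C` on `(−1, 1)` (`n ≥ 1`). -/
theorem abs_gaussRule_le {n : ℕ} (hn : 1 ≤ n) {f : ℝ → ℝ} {C : ℝ} (hf : ∀ x ∈ Ioo (-1 : ℝ) 1, |f x| ≤ C) :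
    |gaussRule n f| ≤ 2 * C := by
  have hw : ∀ i ∈ nodes n, 0 < weight (nodes n) i :=
    fun i hi => weight_pos hn (card_nodes n) (fun _ hr => legP_eq_zero_of_mem_nodes hr) hi
  have hsum := sum_weight hn (card_nodes n) (fun _ hr => legP_eq_zero_of_mem_nodes hr)
  calc |gaussRule n f| ≤ ∑ i ∈ nodes n, |weight (nodes n) i * f i| := Finset.abs_sum_le_sum_abs _ _
    _ ≤ ∑ i ∈ nodes n, weight (nodes n) i * C := by
        refine Finset.sum_le_sum fun i hi => ?_
        rw [abs_mul, abs_of_pos (hw i hi)]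
        exact mul_le_mul_of_nonneg_left (hf i (nodes_subset_Ioo n hi)) (hw i hi).le
    _ = 2 * C := by rw [← Finset.sum_mul, hsum]

/-! ### Convergence -/

/-- **STIELTJES' THEOREM for Gauss–Legendre quadrature**: for every `f` continuous on `[−1, 1]`,
`gaussRule n f → ∫_{−1}^{1} f`. -/
theorem tendsto_gaussRule {f : ℝ → ℝ} (hf : ContinuousOn f (Icc (-1 : ℝ) 1)) :
    Tendsto (fun n => gaussRule n f) atTop (𝓝 (∫ x in (-1 : ℝ)..1, f x)) := by
  rw [Metric.tendsto_atTop]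
  intro ε hε
  obtain ⟨p, hp⟩ := exists_polynomial_near_of_continuousOn (-1) 1 f hf (ε / 5) (by positivity)
  refine ⟨p.natDegree + 1, fun n hn => ?_⟩
  have hn1 : 1 ≤ n := by omega
  have hdeg : p.natDegree ≤ 2 * n - 1 := by omega
  have hfi : IntervalIntegrable f MeasureTheory.volume (-1 : ℝ) 1 :=
    hf.intervalIntegrable_of_Icc (by norm_num)
  have hpi : IntervalIntegrable (fun x => p.eval x) MeasureTheory.volume (-1 : ℝ) 1 :=
    p.continuous.intervalIntegrable _ _
  -- `∫ f = ∫ p + ∫ (f − p)` and `Q f = Q p + Q (f − p)`, with `∫ p = Q p`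
  have hsplit : (∫ x in (-1 : ℝ)..1, f x) = (∫ x in (-1 : ℝ)..1, p.eval x) + ∫ x in (-1 : ℝ)..1, (f x - p.eval x) := by
    rw [← integral_add hpi (hfi.sub hpi)]
    refine integral_congr fun x _ => ?_
    ring
  have hQ : gaussRule n f = gaussRule n (fun x => p.eval x) + gaussRule n (fun x => f x - p.eval x) := by
    rw [gaussRule_sub]
    ring
  -- `|∫ (f − p)| ≤ 2 · ε/5`
  have h1 : |∫ x in (-1 : ℝ)..1, (f x - p.eval x)| ≤ ε / 5 * 2 := by
    have := norm_integral_le_of_norm_le_const (a := (-1 : ℝ)) (b := 1) (C := ε / 5)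
      (f := fun x => f x - p.eval x) fun x hx => by
        rw [Real.norm_eq_abs, abs_sub_comm]
        have hx' : x ∈ Icc (-1 : ℝ) 1 := by
          rw [uIoc_of_le (by norm_num)] at hx
          exact Ioc_subset_Icc_self hx
        exact (hp x hx').le
    rw [Real.norm_eq_abs] at this
    norm_num at this ⊢
    linarith
  -- `|Q (f − p)| ≤ 2 · ε/5`
  have h2 : |gaussRule n (fun x => f x - p.eval x)| ≤ 2 * (ε / 5) :=
    abs_gaussRule_le hn1 fun x hx => by
      rw [abs_sub_comm]
      exact (hp x (Ioo_subset_Icc_self hx)).le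
  rw [Real.dist_eq, hsplit, hQ, gaussRule_eq_integral hn1 hdeg]
  calc |(∫ x in (-1 : ℝ)..1, p.eval x) + gaussRule n (fun x => f x - p.eval x)
        - ((∫ x in (-1 : ℝ)..1, p.eval x) + ∫ x in (-1 : ℝ)..1, (f x - p.eval x))|
      = |gaussRule n (fun x => f x - p.eval x) - ∫ x in (-1 : ℝ)..1, (f x - p.eval x)| := by ring_nf
    _ ≤ |gaussRule n (fun x => f x - p.eval x)| + |∫ x in (-1 : ℝ)..1, (f x - p.eval x)| := abs_sub _ _
    _ < ε := by linarith

/-- The limit, spelled out with the explicit weights: `Σ_{i ∈ nodes n} w_i f(x_i) → ∫_{−1}^{1} f`. -/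
theorem tendsto_sum_weight_mul {f : ℝ → ℝ} (hf : ContinuousOn f (Icc (-1 : ℝ) 1)) :
    Tendsto (fun n => ∑ i ∈ nodes n, weight (nodes n) i * f i) atTop (𝓝 (∫ x in (-1 : ℝ)..1, f x)) :=
  tendsto_gaussRule hf

end Summit.Ventures.HodgeRepro2.T5SU11GaussLegendreConvergence
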